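import Literature.AlgebraicGeometry.HodgeTheory.ThetaTraceTimesCMProductSpan
import Summits.HodgeConjecture.HodgeConjecture.Theses.RankFourFaces
import Summits.HodgeConjecture.HodgeConjecture.Theorems.Ring2MotivProductCells
import HarnessLib

/-!
# Ring 2 · route `motiv` (generation 138) — product cells `A × C`, `C` of CM type, for `A` with the `Θ`-trace condition / of Weil type with balanced multiplicities: HC_CM ∧ HC(A) ⟹ HC(A × C) with NO printed-fact binder

HONEST FRAMING: research route conditional on HC_CM; not a corollary; Q11.4-sentence-2 already refuted in dim ≥ 3.

Cell `pub-hodge-ring2`, seat `motiv` (gen 138; offered to LEAD as `F-motiv-g138-1`). Summit-side rows ONLY: `HC_CM` is a HYPOTHESIS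
(binder `hCM : RankFourFaces.CMAbelianHodge`, the tree item), never cited as a fact; HC for the non-CM factor `A` is a
hypothesis `HodgeConjectureFor A.dim A.X` unless a refereed row supplies it. The mathematics (UNCONDITIONAL) is in
`Literature/AlgebraicGeometry/Motives/HodgeThetaDerivedTimesAbelian.lean` (the Lie step under the `Θ`-trace condition) and
`Literature/AlgebraicGeometry/HodgeTheory/ThetaTraceTimesCMProductSpan.lean` (`hodgeClassesProductSpan_of_thetaTrace_of_isOfCMType`,
`hodgeThetaTraceCondition_of_balanced`). Compared with `Theorems/Ring2MotivProductSemisimpleCMFactor.lean`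
(`hodgeConjectureFor_prod_of_cmAbelianHodge_of_semisimple`), the rows here carry NEITHER the printed-fact binder
`hG : Gordon1999_hodgeClassesProductSpan_of_semisimple` NOR `hA : HasSemisimpleHodgeGroup A`: on the balanced class the product
span is PROVED. Not reachable this way: (r1) type IV with unbalanced multiplicities (the trace condition fails); (r2) non-isotypic
`A` with centre a product of fields (multi-generator version not written); (r3) the named fact
`Gordon1999_hodgeClassesProductSpan_of_semisimple` AS TYPED (finite centre of the Tannaka-free carrier) — BYPASSED on the `Θ`-trace
class, NOT discharged (no `_holds`); the tree's row with `hG` / `hA` stands as typed.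

* `hodgeConjectureFor_prod_of_cmAbelianHodge_of_thetaTrace` — HC_CM ∧ `HodgeThetaTraceCondition A` ∧ `C` CM ∧ HC(A) ⟹ HC(A × C).
* `hodgeConjectureFor_prod_of_cmAbelianHodge_weilType_of_link` / `…_weilType` — the same for `A` with `φ`, `P` irreducible,
  `P(φ) = 0`, central pull-backs polynomial in `φ^*`, balanced multiplicities (the link as a hypothesis / proved by
  `weilTypeThetaTraceLink_holds`).
* `hodgeConjectureFor_prod_of_hodgeConjecture_thetaTrace` — under the full conjecture (bookkeeping).
* CELLS (`Theorems/Ring2MotivProductCells` framework): `cellProductSpan_of_thetaTrace` = Instance 3 of `CellProductSpan`, BINDER-FREE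
  (next to `cellProductSpan_of_lombardo hL`, `cellProductSpan_of_gordon hG`), `thetaTraceCell_of_noTypeIVCell`, and the twins WITHOUT `hG`
  of the Gordon-keyed rows: `hodgeConjectureFor_of_prodCMCell_thetaTrace_cm_dim_le_three`, `…_thetaTrace_of_cmAbelianHodge`,
  `forall_prodCMCell_thetaTrace_top_iff` (EXACTNESS `HC(𝒜_Θ × CM) ↔ HC(𝒜_Θ) ∧ HC_CM`), `forall_prodCMCell_thetaTrace_cm_dim_le_three_iff`.

[cite: Gordon1999HodgeAVSurvey, §3 proof of the Theorem (last step) and 2.16 Proposition (1)] [cite: MoonenZarhin1998WeilClasses, §1 Remark (1) after Criterion (2)]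
[cite: Milne1999, §7 p. 72]
-/

noncomputable section

set_option linter.dupNamespace false

namespace Summit.HodgeConjecture.HodgeConjecture.Ring2.Motiv

open CategoryTheory
open Literature.AlgebraicGeometry Literature.AlgebraicGeometry.Motives
open Literature.AlgebraicGeometry.HodgeTheory
open Literature.AlgebraicTopology.SingularHomology
open Summit.HodgeConjecture.HodgeConjecture.Theses

/-- **HC(A × C) from Hodge-for-CM through the CM factor, `A` with the `Θ`-trace condition** (type IV allowed; no
binder `hG : Gordon1999_hodgeClassesProductSpan_of_semisimple` — that fact is BYPASSED on the `Θ`-trace class, NOT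
discharged; the span statement is proved directly): `HC_CM` (tree item `RankFourFaces.CMAbelianHodge`, a HYPOTHESIS, used once for HC(C)) and HC for `A` give
HC for `A.prod C`. [cite: Lombardo2016, Lemma 3.4 (p. 1229)] [cite: MoonenZarhin1999LowDim, §3 (3.1)] -/
theorem hodgeConjectureFor_prod_of_cmAbelianHodge_of_thetaTrace (hCM : RankFourFaces.CMAbelianHodge)
    (A C : AbelianVariety ℂ) (hB : HodgeThetaTraceCondition A) (hCt : Milne1999.IsOfCMType C)
    (hHA : HodgeConjectureFor A.dim A.X) : HodgeConjectureFor (A.prod C).dim (A.prod C).X :=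
  hodgeConjectureFor_prod_of_thetaTrace_of_cmHodgeHypothesis hCM A C hB hCt hHA

/-- **Weil type with balanced multiplicities × CM factor, against the typed link** (`WeilTypeThetaTraceLink`, proved
in Part B §7: apply to `weilTypeThetaTraceLink_holds`, or use the next theorem). [cite: MoonenZarhin1998WeilClasses,
§1 Remark (1) after Criterion (2)] [cite: Lombardo2016, Lemma 3.4 (p. 1229)] -/
theorem hodgeConjectureFor_prod_of_cmAbelianHodge_weilType_of_link (hCM : RankFourFaces.CMAbelianHodge)
    (hL : WeilTypeThetaTraceLink) {A : AbelianVariety ℂ} {φ : A ⟶ A} {P : Polynomial ℤ} {e m : ℕ}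
    (hPm : P.Monic) (hPe : P.natDegree = e) (hPirr : Irreducible (P.map (Int.castRingHom ℚ)))
    (hφ : Polynomial.eval₂ (Int.castRingHom (CategoryTheory.End A)) (φ : CategoryTheory.End A) P = 0)
    (her : e * (2 * m) = 2 * A.dim) (hm : m ≠ 0)
    (hE : ∀ u : A ⟶ A, VanGeemen1994.pullbackOne A u ∈ Milne1999.centralizerAlgebra A →
      VanGeemen1994.pullbackOne A u ∈ Algebra.adjoin ℂ {VanGeemen1994.pullbackOne A φ})
    (hbal : ∀ ρ : ℂ, Polynomial.eval₂ (Int.castRingHom ℂ) ρ P = 0 →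
      eigenMultiplicity A φ ρ = eigenMultiplicity A φ (starRingEnd ℂ ρ))
    (C : AbelianVariety ℂ) (hCt : Milne1999.IsOfCMType C) (hHA : HodgeConjectureFor A.dim A.X) :
    HodgeConjectureFor (A.prod C).dim (A.prod C).X :=
  hodgeConjectureFor_prod_weilType_of_link_of_cmHodgeHypothesis hL hCM hPm hPe hPirr hφ her hm hE hbal C hCt hHA

/-- **Weil type (centre `⊆ ℚ(φ)`, balanced multiplicities) × CM factor — NO printed-fact binder**: `HC_CM`
(`RankFourFaces.CMAbelianHodge`, a HYPOTHESIS) and HC(`A`) give HC(`A × C`); the link is proved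
(`hodgeThetaTraceCondition_of_balanced`). [cite: MoonenZarhin1998WeilClasses, §1 Remark (1) after Criterion (2)]
[cite: Lombardo2016, Lemma 3.4 (p. 1229)] -/
theorem hodgeConjectureFor_prod_of_cmAbelianHodge_weilType (hCM : RankFourFaces.CMAbelianHodge)
    {A : AbelianVariety ℂ} {φ : A ⟶ A} {P : Polynomial ℤ} (hPm : P.Monic)
    (hPirr : Irreducible (P.map (Int.castRingHom ℚ)))
    (hφ : Polynomial.eval₂ (Int.castRingHom (CategoryTheory.End A)) (φ : CategoryTheory.End A) P = 0)
    (hE : ∀ u : A ⟶ A, VanGeemen1994.pullbackOne A u ∈ Milne1999.centralizerAlgebra A →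
      VanGeemen1994.pullbackOne A u ∈ Algebra.adjoin ℂ {VanGeemen1994.pullbackOne A φ})
    (hbal : ∀ ρ : ℂ, Polynomial.eval₂ (Int.castRingHom ℂ) ρ P = 0 →
      eigenMultiplicity A φ ρ = eigenMultiplicity A φ (starRingEnd ℂ ρ))
    (C : AbelianVariety ℂ) (hCt : Milne1999.IsOfCMType C) (hHA : HodgeConjectureFor A.dim A.X) :
    HodgeConjectureFor (A.prod C).dim (A.prod C).X :=
  hodgeConjectureFor_prod_weilType_of_cmHodgeHypothesis hCM hPm hPirr hφ hE hbal C hCt hHA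

/-- **On path**: both rows are cases of the Hodge conjecture. [cite: Deligne2000, §1] -/
theorem hodgeConjectureFor_prod_of_hodgeConjecture_thetaTrace
    (h : ∀ ⦃n : ℕ⦄ ⦃X : SchemeOver ℂ⦄, IsSmoothProjective n X → HodgeConjectureFor n X)
    (A C : AbelianVariety ℂ) : HodgeConjectureFor (A.prod C).dim (A.prod C).X :=
  h AbelianVariety.isSmoothProjective_holds

/-! ### The `Θ`-trace CELL (framework of `Theorems/Ring2MotivProductCells`): Instance 3, BINDER-FREE -/

section Cells

variable {𝒜 𝒞 : AbelianVariety ℂ → Prop}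

/-- **Instance 3 of the cell's splitting hypothesis — `𝒜 ⊆ {A with the Θ-trace condition}`, NO binder**: next to
`cellProductSpan_of_lombardo hL` (no type IV; `hL` a theorem of the tree since programme R5) and `cellProductSpan_of_gordon hG`
(`Hg(A)` semisimple; `hG` a printed fact), the `Θ`-trace class needs no printed fact at all
(`hodgeClassesProductSpan_of_thetaTrace_of_isOfCMType`). It CONTAINS the no-type-IV class
(`hodgeThetaTraceCondition_of_hasNoTypeIVFactor`) and every isotypic `A` with balanced multiplicities
(`hodgeThetaTraceCondition_of_balanced`). [cite: Gordon1999HodgeAVSurvey, App. B §3 (pp. 13–14) and 2.16 Proposition (1)]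
[cite: MoonenZarhin1999LowDim, §3 (3.1)] [cite: Lombardo2016, Lemma 3.4 (p. 1229)] -/
theorem cellProductSpan_of_thetaTrace (h𝒜 : ∀ A, 𝒜 A → HodgeThetaTraceCondition A) : CellProductSpan 𝒜 :=
  fun A _ hA hCt ↦ hodgeClassesProductSpan_of_thetaTrace_of_isOfCMType (h𝒜 A hA) hCt

/-- The no-type-IV cell lies in the `Θ`-trace cell. [cite: MoonenZarhin1999LowDim, §1] -/
theorem thetaTraceCell_of_noTypeIVCell {A : AbelianVariety ℂ} (hA : 𝒜 A ∧ HasNoTypeIVFactor A) :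
    𝒜 A ∧ HodgeThetaTraceCondition A :=
  ⟨hA.1, hodgeThetaTraceCondition_of_hasNoTypeIVFactor hA.2⟩

/-- Row §2 of `Ring2MotivProductCells` (CM factor `dim ≤ 3`, HC_CM NOT needed) on the `Θ`-trace class — the twin of
`hodgeConjectureFor_of_prodCMCell_semisimple_cm_dim_le_three_of_gordon` WITHOUT `hG`.
[cite: MoonenZarhin1999LowDim, §3 (3.1) and (0.3)] -/
theorem hodgeConjectureFor_of_prodCMCell_thetaTrace_cm_dim_le_three
    (h𝒜 : ∀ A : AbelianVariety ℂ, 𝒜 A ∧ HodgeThetaTraceCondition A → HodgeConjectureFor A.dim A.X)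
    {X : AbelianVariety ℂ} (hX : ProdCMCell (fun A ↦ 𝒜 A ∧ HodgeThetaTraceCondition A) (fun C ↦ C.dim ≤ 3) X) :
    HodgeConjectureFor X.dim X.X :=
  hodgeConjectureFor_of_prodCMCell_cm_dim_le_three (cellProductSpan_of_thetaTrace fun _ hA ↦ hA.2) h𝒜 hX

/-- Row §3 of `Ring2MotivProductCells` (arbitrary CM factor, `HC_CM` BY NAME as the hypothesis `hCM`) on the
`Θ`-trace class — the twin of `hodgeConjectureFor_of_prodCMCell_semisimple_of_cmAbelianHodge_of_gordon` WITHOUT `hG`.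
[cite: Milne1999, §7 (H)] [cite: MoonenZarhin1999LowDim, §3 (3.1)] -/
theorem hodgeConjectureFor_of_prodCMCell_thetaTrace_of_cmAbelianHodge (hCM : RankFourFaces.CMAbelianHodge)
    (h𝒜 : ∀ A : AbelianVariety ℂ, 𝒜 A ∧ HodgeThetaTraceCondition A → HodgeConjectureFor A.dim A.X)
    {X : AbelianVariety ℂ} (hX : ProdCMCell (fun A ↦ 𝒜 A ∧ HodgeThetaTraceCondition A) 𝒞 X) :
    HodgeConjectureFor X.dim X.X :=
  hodgeConjectureFor_of_prodCMCell_of_cmAbelianHodge hCM (cellProductSpan_of_thetaTrace fun _ hA ↦ hA.2) h𝒜 hX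

/-- **EXACTNESS against `HC_CM` on the `Θ`-trace cell** — the twin of
`forall_prodCMCell_semisimple_top_iff_of_gordon` WITHOUT `hG`: `HC(𝒜_Θ × CM) ↔ HC(𝒜_Θ) ∧ HC_CM`
(KIND of `HC_CM` = LOAD-BEARING, exactly; unconditional in both directions). [cite: Milne1999, §7 (H)]
[cite: MoonenZarhin1999LowDim, §3 (3.1)] -/
theorem forall_prodCMCell_thetaTrace_top_iff
    (hA₀ : ∃ A : AbelianVariety ℂ, 𝒜 A ∧ HodgeThetaTraceCondition A)
    (hC₀ : ∃ C : AbelianVariety ℂ, Milne1999.IsOfCMType C) :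
    (∀ X : AbelianVariety ℂ, ProdCMCell (fun A ↦ 𝒜 A ∧ HodgeThetaTraceCondition A) (fun _ ↦ True) X →
        HodgeConjectureFor X.dim X.X) ↔
      (∀ A : AbelianVariety ℂ, 𝒜 A ∧ HodgeThetaTraceCondition A → HodgeConjectureFor A.dim A.X) ∧
        RankFourFaces.CMAbelianHodge :=
  forall_prodCMCell_top_iff (cellProductSpan_of_thetaTrace fun _ hA ↦ hA.2) hA₀ hC₀

/-- `dim C ≤ 3` exactness on the `Θ`-trace cell (HC_CM ABSENT, exactly): `HC(cell) ↔ HC(𝒜_Θ)`.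
[cite: MoonenZarhin1999LowDim, §3 (3.1) and (0.3)] -/
theorem forall_prodCMCell_thetaTrace_cm_dim_le_three_iff
    (hC₀ : ∃ C : AbelianVariety ℂ, Milne1999.IsOfCMType C ∧ C.dim ≤ 3) :
    (∀ X : AbelianVariety ℂ, ProdCMCell (fun A ↦ 𝒜 A ∧ HodgeThetaTraceCondition A) (fun C ↦ C.dim ≤ 3) X →
        HodgeConjectureFor X.dim X.X) ↔
      ∀ A : AbelianVariety ℂ, 𝒜 A ∧ HodgeThetaTraceCondition A → HodgeConjectureFor A.dim A.X :=
  forall_prodCMCell_cm_dim_le_three_iff (cellProductSpan_of_thetaTrace fun _ hA ↦ hA.2) hC₀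

end Cells

end Summit.HodgeConjecture.HodgeConjecture.Ring2.Motiv

end
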